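import Summits.SmoothPoincare4.SmoothPoincare4.Theorems.CongruenceShadowsLieGateIdentityWords

/-!
# The Lie gate identity and the pair identity for coordinate cut systems (general form)

Support file for item stmt-SmoothPoincare4-13527 (`LieGateIdentity`, route
`SmoothPoincare4/CongruenceShadows`, card artin-approximation-trisection-groups K1 (ii)+(iii)),
over the definitions of `Literature/Algebra/Lie/SurfaceLieAlgebra.lean` (`SurfaceLieAlgebra R g`,
`grade`, `derDegree`, `cutIdeal`, `cutStabilizerDegree`, `s4CutSystem`).

Let `A, B, C ⊆ Fin g × Bool` be *coordinate* cut systems of `𝔰_g(R)` (each contains exactly one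
letter of every handle) and `𝔞_n, 𝔟_n, 𝔠_n ⊆ Der_n(𝔰_g(R))` the degree-`n` parts of the
stabilisers of the cut ideals `I_A, I_B, I_C` (`cutStabilizerDegree`).
* `gate_general` (GATE): if no letter lies in all three systems then
  `(𝔞 + 𝔠) ∩ (𝔟 + 𝔠) = (𝔞 ∩ 𝔟) + 𝔠` in every degree `n`, over every commutative ring `R`.
* `pair_general` (PAIR): `𝔞 + 𝔠 = {D ∈ Der_n | D(x) ∈ I_A + I_C for all x ∈ A ∩ C}`.

Proof of GATE.  A derivation is its generator data `(D(gen x))_x`, subject only to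
`Φ(data) = 0` (`exists_derivation`), and the stabiliser conditions are letterwise
(`mem_derStabilizer_cutIdeal_iff`).  For `D = D_A + D_C = D_B + D_C'` split the data of `D_A`
letter by letter (each letter lies in at most two systems) as `e_AB + e_AC`, `e_AB` in the `A`- and
`B`-conditions, `e_AC` in the `A`- and `C`-conditions, `e_AB - D_B` in the `B`- and
`C`-conditions.  The obstruction `q = Φ(e_AB) = Φ(e_AB - D_B) = -Φ(e_AC)` lies in
`I_A ∩ I_B ∩ I_C` and has bracket length `n + 2`; by the word calculus
(`mem_span_touch` three times: `ω` lies in every cut ideal, so the sections `σ_S` exist) it is in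
the span of the words of length `n + 2` touching `A`, `B` and `C`, hence `q = Φ(r)` for correction
data `r` in all three conditions (`exists_data`).  Then `e_AB - r` and `e_AC + r` are data of
derivations `E₁ ∈ 𝔞 ∩ 𝔟`, `E₂ ∈ 𝔞 ∩ 𝔠` with `D_A = E₁ + E₂`, so `D = E₁ + (E₂ + D_C)`.
PAIR is the same argument with two systems, after a graded splitting of `I_A + I_C`
(`exists_graded_split`).  (By inclusion–exclusion GATE is equivalent to `Der_n = 𝔞 + 𝔟 + 𝔠`;
the card's ten defect-`0` computations, e.g. `dim (𝔞 + 𝔠) = 1714` of `dim Der₂(𝔰₆) = 1715`,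
are instances.)

No new definitions, no named facts.
-/

-- the prescribed namespace `Summit.<P>.<Sub>.…` duplicates `SmoothPoincare4` (P = Sub)
set_option linter.dupNamespace false

open Literature.Algebra.Lie Literature.Algebra.Lie.SurfaceLieAlgebra

namespace Summit.SmoothPoincare4.SmoothPoincare4.Theorems.LieGateIdentity

section Gate

variable {R : Type*} [CommRing R] {g : ℕ}

/-- A coordinate cut system hits every handle. [folklore] -/
theorem hits_of_coord {S : Set (Fin g × Bool)} (hS : ∀ x : Fin g × Bool, x ∈ S ↔ (x.1, !x.2) ∉ S)
    (i : Fin g) : (i, false) ∈ S ∨ (i, true) ∈ S := by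
  by_cases h : (i, false) ∈ S
  · exact Or.inl h
  · exact Or.inr ((hS (i, true)).2 h)

/-- An element of `I_A ∩ I_B ∩ I_C` of bracket length `n + 2` is `Φ` of correction data of length
`n + 1` lying in the three coordinate stabiliser conditions. [folklore] -/
theorem exists_correction {A B C : Set (Fin g × Bool)}
    (hA : ∀ x : Fin g × Bool, x ∈ A ↔ (x.1, !x.2) ∉ A)
    (hB : ∀ x : Fin g × Bool, x ∈ B ↔ (x.1, !x.2) ∉ B)
    (hC : ∀ x : Fin g × Bool, x ∈ C ↔ (x.1, !x.2) ∉ C) {n : ℕ} {q : SurfaceLieAlgebra R g}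
    (hq : q ∈ grade R g (n + 2)) (hqA : q ∈ cutIdeal R g A) (hqB : q ∈ cutIdeal R g B)
    (hqC : q ∈ cutIdeal R g C) :
    ∃ r : Fin g × Bool → SurfaceLieAlgebra R g, (∀ x, r x ∈ grade R g (n + 1)) ∧
      (∀ x ∈ A, r x ∈ cutIdeal R g A) ∧ (∀ x ∈ B, r x ∈ cutIdeal R g B) ∧
      (∀ x ∈ C, r x ∈ cutIdeal R g C) ∧ (∑ i : Fin g, (⁅a R g i, r (i, true)⁆ - ⁅b R g i, r (i,
          false)⁆)) = q := by
  have hq' : q ∈ Submodule.span R (bracketWord (gen R g) ''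
      {w | w.length = n + 2}) := hq
  have h3 := mem_span_touch (hits_of_coord hC)
    (mem_span_touch (hits_of_coord hB) (mem_span_touch (hits_of_coord hA) hq' hqA) hqB) hqC
  obtain ⟨r, hr, hrT, hrq⟩ := exists_data (R := R) (T := fun S => S = A ∨ S = B ∨ S = C)
    (by rintro S (rfl | rfl | rfl) <;> assumption) (d := n)
    (W := {w | ((w.length = n + 2 ∧ ∃ x ∈ (FreeMagma.lift (fun x => Multiplicative.ofAdd ({x} :
        Multiset _)) w).toAdd, x ∈ A) ∧ ∃ x ∈ (FreeMagma.lift (fun x => Multiplicative.ofAdd ({x} :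
        Multiset _)) w).toAdd, x ∈ B) ∧ ∃ x ∈ (FreeMagma.lift (fun x => Multiplicative.ofAdd ({x} :
        Multiset _)) w).toAdd, x ∈ C})
    (by
      rintro w ⟨⟨⟨hl, hwA⟩, hwB⟩, hwC⟩
      exact ⟨hl, by rintro S (rfl | rfl | rfl) <;> assumption⟩) h3
  exact ⟨r, hr, hrT A (Or.inl rfl), hrT B (Or.inr (Or.inl rfl)), hrT C (Or.inr (Or.inr rfl)), hrq⟩

/-- **The Lie gate identity, general form.** For three coordinate cut systems `A, B, C` of
`𝔰_g(R)` (each contains exactly one letter of every handle) with no common letter, the degree-`n`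
stabilisers `𝔞, 𝔟, 𝔠 ⊆ Der_n(𝔰_g(R))` of the cut ideals satisfy
`(𝔞 + 𝔠) ∩ (𝔟 + 𝔠) = (𝔞 ∩ 𝔟) + 𝔠` in every degree `n`, over every commutative ring `R`.
Proof: for `D = D_A + D_C = D_B + D_C'` split the generator data of `D_A` letter by letter into
`e_AB + e_AC` with `e_AB` in the `A`- and `B`-conditions, `e_AC` in the `A`- and `C`-conditions and
`e_AB - D_B` in the `B`- and `C`-conditions; then `Φ(e_AB) ∈ I_A ∩ I_B ∩ I_C` is `Φ` of correction
data `r` (`exists_correction`), and `e_AB - r`, `e_AC + r` extend to derivations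
(`exists_derivation`) realising `D_A ∈ (𝔞 ∩ 𝔟) + 𝔠`. [folklore] -/
theorem gate_general {A B C : Set (Fin g × Bool)}
    (hA : ∀ x : Fin g × Bool, x ∈ A ↔ (x.1, !x.2) ∉ A)
    (hB : ∀ x : Fin g × Bool, x ∈ B ↔ (x.1, !x.2) ∉ B)
    (hC : ∀ x : Fin g × Bool, x ∈ C ↔ (x.1, !x.2) ∉ C)
    (hABC : ∀ x, x ∈ A → x ∈ B → x ∉ C) (n : ℕ) :
    (cutStabilizerDegree R g A n ⊔ cutStabilizerDegree R g C n) ⊓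
        (cutStabilizerDegree R g B n ⊔ cutStabilizerDegree R g C n) =
      (cutStabilizerDegree R g A n ⊓ cutStabilizerDegree R g B n) ⊔ cutStabilizerDegree R g C n := by
  classical
  refine le_antisymm ?_ (le_inf (sup_le_sup_right inf_le_left _) (sup_le_sup_right inf_le_right _))
  rintro D ⟨hD₁, hD₂⟩
  obtain ⟨DA, hDA, DC, hDC, rfl⟩ := Submodule.mem_sup.1 hD₁
  obtain ⟨DB, hDB, DC', hDC', hsum⟩ := Submodule.mem_sup.1 hD₂
  -- the relation, letter by letter
  have hrel : ∀ x, DA (gen R g x) - DB (gen R g x) = DC' (gen R g x) - DC (gen R g x) := by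
    intro x
    have := LieDerivation.congr_fun hsum (gen R g x)
    rw [LieDerivation.add_apply, LieDerivation.add_apply] at this
    rw [sub_eq_sub_iff_add_eq_add, ← this, add_comm]
  -- the letterwise splitting of the data of `D_A`
  let eAB : Fin g × Bool → SurfaceLieAlgebra R g := fun x =>
    if x ∈ A then (if x ∈ B then 0 else DA (gen R g x))
    else (if x ∈ B then DB (gen R g x) else DA (gen R g x))
  let eAC : Fin g × Bool → SurfaceLieAlgebra R g := fun x =>
    if x ∈ A then (if x ∈ B then DA (gen R g x) else 0)
    else (if x ∈ B then DA (gen R g x) - DB (gen R g x) else 0)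
  have hsumAB : ∀ x, eAB x + eAC x = DA (gen R g x) := by
    intro x
    by_cases hxA : x ∈ A <;> by_cases hxB : x ∈ B <;> simp [eAB, eAC, hxA, hxB]
  have heAB_grade : ∀ x, eAB x ∈ grade R g (n + 1) := by
    intro x
    by_cases hxA : x ∈ A <;> by_cases hxB : x ∈ B <;>
      simp only [eAB, hxA, hxB, if_true, if_false] <;>
      first
        | exact Submodule.zero_mem _
        | exact apply_gen_mem_grade hDA x
        | exact apply_gen_mem_grade hDB x
  have heAC_grade : ∀ x, eAC x ∈ grade R g (n + 1) := by
    intro x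
    by_cases hxA : x ∈ A <;> by_cases hxB : x ∈ B <;>
      simp only [eAC, hxA, hxB, if_true, if_false] <;>
      first
        | exact Submodule.zero_mem _
        | exact apply_gen_mem_grade hDA x
        | exact sub_mem (apply_gen_mem_grade hDA x) (apply_gen_mem_grade hDB x)
  have heAB_A : ∀ x ∈ A, eAB x ∈ cutIdeal R g A := by
    intro x hxA
    by_cases hxB : x ∈ B <;> simp only [eAB, hxA, hxB, if_true, if_false]
    · exact LieSubmodule.zero_mem _
    · exact apply_gen_mem_cutIdeal hDA hxA
  have heAB_B : ∀ x ∈ B, eAB x ∈ cutIdeal R g B := by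
    intro x hxB
    by_cases hxA : x ∈ A <;> simp only [eAB, hxA, hxB, if_true, if_false]
    · exact LieSubmodule.zero_mem _
    · exact apply_gen_mem_cutIdeal hDB hxB
  have heAC_A : ∀ x ∈ A, eAC x ∈ cutIdeal R g A := by
    intro x hxA
    by_cases hxB : x ∈ B <;> simp only [eAC, hxA, hxB, if_true, if_false]
    · exact apply_gen_mem_cutIdeal hDA hxA
    · exact LieSubmodule.zero_mem _
  have heAC_C : ∀ x ∈ C, eAC x ∈ cutIdeal R g C := by
    intro x hxC
    by_cases hxA : x ∈ A <;> by_cases hxB : x ∈ B <;> simp only [eAC, hxA, hxB, if_true, if_false]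
    · exact absurd hxC (hABC x hxA hxB)
    · exact LieSubmodule.zero_mem _
    · rw [hrel x]; exact sub_mem (apply_gen_mem_cutIdeal hDC' hxC) (apply_gen_mem_cutIdeal hDC hxC)
    · exact LieSubmodule.zero_mem _
  -- `e_BC = e_AB - D_B` lies in the `B`- and `C`-conditions
  have heBC_C : ∀ x ∈ C, eAB x - DB (gen R g x) ∈ cutIdeal R g C := by
    intro x hxC
    by_cases hxA : x ∈ A <;> by_cases hxB : x ∈ B <;> simp only [eAB, hxA, hxB, if_true, if_false]
    · exact absurd hxC (hABC x hxA hxB)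
    · rw [hrel x]; exact sub_mem (apply_gen_mem_cutIdeal hDC' hxC) (apply_gen_mem_cutIdeal hDC hxC)
    · rw [sub_self]; exact LieSubmodule.zero_mem _
    · rw [hrel x]; exact sub_mem (apply_gen_mem_cutIdeal hDC' hxC) (apply_gen_mem_cutIdeal hDC hxC)
  -- the obstruction `q = Φ(e_AB)` lies in `I_A ∩ I_B ∩ I_C` and has length `n + 2`
  have hqA : (∑ i : Fin g, (⁅a R g i, eAB (i, true)⁆ - ⁅b R g i, eAB (i, false)⁆)) ∈ cutIdeal R g A
      := phi_mem_cutIdeal (hits_of_coord hA) heAB_A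
  have hqB : (∑ i : Fin g, (⁅a R g i, eAB (i, true)⁆ - ⁅b R g i, eAB (i, false)⁆)) ∈ cutIdeal R g B
      := phi_mem_cutIdeal (hits_of_coord hB) heAB_B
  have hΦDB : (∑ i : Fin g, (⁅a R g i, (fun x => DB (gen R g x)) (i, true)⁆ - ⁅b R g i, (fun x => DB
      (gen R g x)) (i, false)⁆)) = 0 := phi_derivation DB
  have hΦDA : (∑ i : Fin g, (⁅a R g i, (fun x => DA (gen R g x)) (i, true)⁆ - ⁅b R g i, (fun x => DA
      (gen R g x)) (i, false)⁆)) = 0 := phi_derivation DA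
  have hqC : (∑ i : Fin g, (⁅a R g i, eAB (i, true)⁆ - ⁅b R g i, eAB (i, false)⁆)) ∈ cutIdeal R g C
      := by
    have h1 : (∑ i : Fin g, (⁅a R g i, (eAB - fun x => DB (gen R g x)) (i, true)⁆ - ⁅b R g i, (eAB -
        fun x => DB (gen R g x)) (i, false)⁆)) ∈ cutIdeal R g C :=
      phi_mem_cutIdeal (hits_of_coord hC) heBC_C
    rwa [phi_sub, hΦDB, sub_zero] at h1
  have hq : (∑ i : Fin g, (⁅a R g i, eAB (i, true)⁆ - ⁅b R g i, eAB (i, false)⁆)) ∈ grade R g (n +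
      2) := phi_mem_grade heAB_grade
  obtain ⟨r, hr, hrA, hrB, hrC, hrq⟩ := exists_correction hA hB hC hq hqA hqB hqC
  -- the two corrected data extend to derivations
  have hΦAC : (∑ i : Fin g, (⁅a R g i, eAC (i, true)⁆ - ⁅b R g i, eAC (i, false)⁆)) = -(∑ i : Fin g,
      (⁅a R g i, eAB (i, true)⁆ - ⁅b R g i, eAB (i, false)⁆)) := by
    have : (∑ i : Fin g, (⁅a R g i, (eAB + eAC) (i, true)⁆ - ⁅b R g i, (eAB + eAC) (i, false)⁆)) = 0
        := by
      rw [show eAB + eAC = fun x => DA (gen R g x) from funext fun x => hsumAB x]; exact hΦDA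
    rw [phi_add] at this
    exact eq_neg_of_add_eq_zero_right this
  obtain ⟨E₁, hE₁⟩ := exists_derivation (eAB - r) (by
    have := phi_sub eAB r
    rw [hrq, sub_self] at this
    simpa [a, b] using this)
  obtain ⟨E₂, hE₂⟩ := exists_derivation (eAC + r) (by
    have := phi_add eAC r
    rw [hrq, hΦAC, neg_add_cancel] at this
    simpa [a, b] using this)
  have hE₁A : E₁ ∈ cutStabilizerDegree R g A n :=
    mem_cutStabilizerDegree_of_gen (fun x hx => by rw [hE₁]; exact sub_mem (heAB_A x hx) (hrA x hx))
      fun x => by rw [hE₁]; exact sub_mem (heAB_grade x) (hr x)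
  have hE₁B : E₁ ∈ cutStabilizerDegree R g B n :=
    mem_cutStabilizerDegree_of_gen (fun x hx => by rw [hE₁]; exact sub_mem (heAB_B x hx) (hrB x hx))
      fun x => by rw [hE₁]; exact sub_mem (heAB_grade x) (hr x)
  have hE₂C : E₂ ∈ cutStabilizerDegree R g C n :=
    mem_cutStabilizerDegree_of_gen (fun x hx => by rw [hE₂]; exact add_mem (heAC_C x hx) (hrC x hx))
      fun x => by rw [hE₂]; exact add_mem (heAC_grade x) (hr x)
  have hDAE : DA = E₁ + E₂ := derivation_ext fun x => by
    rw [LieDerivation.add_apply, hE₁, hE₂, Pi.sub_apply, Pi.add_apply, ← hsumAB x]; abel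
  refine Submodule.mem_sup.2 ⟨E₁, Submodule.mem_inf.2 ⟨hE₁A, hE₁B⟩, E₂ + DC, add_mem hE₂C hDC, ?_⟩
  rw [hDAE]; abel

end Gate

section Pair

variable {R : Type*} [CommRing R] {g : ℕ}

/-- **Graded splitting of `I_A + I_C`.** An element of bracket length `d` in `I_A + I_C`
(`A`, `C` hitting every handle) splits into elements of length `d` in `I_A` and in `I_C`:
it lies in the span of the words of length `d` touching `A ∪ C`, and each such word touches `A`
or `C`. [folklore] -/
theorem exists_graded_split {A C : Set (Fin g × Bool)}
    (hA : ∀ i : Fin g, (i, false) ∈ A ∨ (i, true) ∈ A) {d : ℕ} {u : SurfaceLieAlgebra R g}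
    (hu : u ∈ grade R g d) (huAC : u ∈ cutIdeal R g A ⊔ cutIdeal R g C) :
    ∃ p z : SurfaceLieAlgebra R g, p ∈ grade R g d ∧ p ∈ cutIdeal R g A ∧ z ∈ grade R g d ∧
      z ∈ cutIdeal R g C ∧ p + z = u := by
  have hAC : ∀ i : Fin g, (i, false) ∈ A ∪ C ∨ (i, true) ∈ A ∪ C :=
    fun i => (hA i).imp (Set.mem_union_left _ ·) (Set.mem_union_left _ ·)
  have hu' : u ∈ Submodule.span R (bracketWord (gen R g) '' {w | w.length = d}) := hu
  have huAC' : u ∈ cutIdeal R g (A ∪ C) := by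
    have : cutIdeal R g (A ∪ C) = cutIdeal R g A ⊔ cutIdeal R g C := by
      change LieSubmodule.lieSpan R _ (gen R g '' (A ∪ C)) = _
      rw [Set.image_union, LieSubmodule.span_union]; rfl
    rw [this]; exact huAC
  have h := mem_span_touch hAC hu' huAC'
  have hsplit : Submodule.span R (bracketWord (gen R g) ''
      {w | w.length = d ∧ ∃ x ∈ (FreeMagma.lift (fun x => Multiplicative.ofAdd ({x} : Multiset _))
          w).toAdd, x ∈ A ∪ C}) ≤
      Submodule.span R (bracketWord (gen R g) '' {w | w.length = d ∧ ∃ x ∈ (FreeMagma.lift (fun x =>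
          Multiplicative.ofAdd ({x} : Multiset _)) w).toAdd, x ∈ A}) ⊔
        Submodule.span R (bracketWord (gen R g) '' {w | w.length = d ∧ ∃ x ∈ (FreeMagma.lift (fun x
            => Multiplicative.ofAdd ({x} : Multiset _)) w).toAdd, x ∈ C}) := by
    rw [Submodule.span_le]
    rintro _ ⟨w, ⟨hw, x, hx, hxA | hxC⟩, rfl⟩
    · exact Submodule.mem_sup_left (Submodule.subset_span ⟨w, ⟨hw, x, hx, hxA⟩, rfl⟩)
    · exact Submodule.mem_sup_right (Submodule.subset_span ⟨w, ⟨hw, x, hx, hxC⟩, rfl⟩)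
  obtain ⟨p, hp, z, hz, rfl⟩ := Submodule.mem_sup.1 (hsplit h)
  have hgrade : ∀ (S : Set (Fin g × Bool)),
      Submodule.span R (bracketWord (gen R g) '' {w | w.length = d ∧ ∃ x ∈ (FreeMagma.lift (fun x =>
          Multiplicative.ofAdd ({x} : Multiset _)) w).toAdd, x ∈ S}) ≤
        grade R g d :=
    fun S => Submodule.span_mono (Set.image_mono fun w hw => hw.1)
  have hideal : ∀ (S : Set (Fin g × Bool)),
      Submodule.span R (bracketWord (gen R g) '' {w | w.length = d ∧ ∃ x ∈ (FreeMagma.lift (fun x =>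
          Multiplicative.ofAdd ({x} : Multiset _)) w).toAdd, x ∈ S}) ≤
        (cutIdeal R g S).toSubmodule := fun S => by
    rw [Submodule.span_le]
    rintro _ ⟨w, hw, rfl⟩
    exact bracketWord_mem_cutIdeal hw.2
  exact ⟨p, z, hgrade A hp, hideal A hp, hgrade C hz, hideal C hz, rfl⟩

/-- Two-system version of `exists_correction`: an element of `I_A ∩ I_C` of bracket length
`n + 2` is `Φ` of correction data in the `A`- and `C`-conditions. [folklore] -/
theorem exists_correction₂ {A C : Set (Fin g × Bool)}
    (hA : ∀ x : Fin g × Bool, x ∈ A ↔ (x.1, !x.2) ∉ A)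
    (hC : ∀ x : Fin g × Bool, x ∈ C ↔ (x.1, !x.2) ∉ C) {n : ℕ} {q : SurfaceLieAlgebra R g}
    (hq : q ∈ grade R g (n + 2)) (hqA : q ∈ cutIdeal R g A) (hqC : q ∈ cutIdeal R g C) :
    ∃ r : Fin g × Bool → SurfaceLieAlgebra R g, (∀ x, r x ∈ grade R g (n + 1)) ∧
      (∀ x ∈ A, r x ∈ cutIdeal R g A) ∧ (∀ x ∈ C, r x ∈ cutIdeal R g C) ∧ (∑ i : Fin g, (⁅a R g i, r
          (i, true)⁆ - ⁅b R g i, r (i, false)⁆)) = q := by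
  have hq' : q ∈ Submodule.span R (bracketWord (gen R g) '' {w | w.length = n + 2}) := hq
  have h2 := mem_span_touch (hits_of_coord hC) (mem_span_touch (hits_of_coord hA) hq' hqA) hqC
  obtain ⟨r, hr, hrT, hrq⟩ := exists_data (R := R) (T := fun S => S = A ∨ S = C)
    (by rintro S (rfl | rfl) <;> assumption) (d := n)
    (W := {w | (w.length = n + 2 ∧ ∃ x ∈ (FreeMagma.lift (fun x => Multiplicative.ofAdd ({x} :
        Multiset _)) w).toAdd, x ∈ A) ∧ ∃ x ∈ (FreeMagma.lift (fun x => Multiplicative.ofAdd ({x} :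
        Multiset _)) w).toAdd, x ∈ C})
    (by
      rintro w ⟨⟨hl, hwA⟩, hwC⟩
      exact ⟨hl, by rintro S (rfl | rfl) <;> assumption⟩) h2
  exact ⟨r, hr, hrT A (Or.inl rfl), hrT C (Or.inr rfl), hrq⟩

/-- **The pair identity, general form.** For two coordinate cut systems `A, C` of `𝔰_g(R)`, a
degree-`n` derivation is a sum of a derivation stabilising `I_A` and one stabilising `I_C` iff it
sends the common letters `A ∩ C` into `I_A + I_C`. [folklore] -/
theorem pair_general {A C : Set (Fin g × Bool)}
    (hA : ∀ x : Fin g × Bool, x ∈ A ↔ (x.1, !x.2) ∉ A)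
    (hC : ∀ x : Fin g × Bool, x ∈ C ↔ (x.1, !x.2) ∉ C) (n : ℕ)
    (D : LieDerivation R (SurfaceLieAlgebra R g) (SurfaceLieAlgebra R g)) :
    D ∈ cutStabilizerDegree R g A n ⊔ cutStabilizerDegree R g C n ↔
      D ∈ derDegree R g n ∧
        ∀ x, x ∈ A → x ∈ C → D (gen R g x) ∈ cutIdeal R g A ⊔ cutIdeal R g C := by
  classical
  constructor
  · intro hD
    obtain ⟨DA, hDA, DC, hDC, rfl⟩ := Submodule.mem_sup.1 hD
    refine ⟨add_mem ((mem_cutStabilizerDegree_iff R g).1 hDA).2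
      ((mem_cutStabilizerDegree_iff R g).1 hDC).2, fun x hxA hxC => ?_⟩
    rw [LieDerivation.add_apply]
    exact add_mem (LieSubmodule.mem_sup_left (apply_gen_mem_cutIdeal hDA hxA))
      (LieSubmodule.mem_sup_right (apply_gen_mem_cutIdeal hDC hxC))
  · rintro ⟨hdeg, hpair⟩
    have hgr : ∀ x, D (gen R g x) ∈ grade R g (n + 1) := mem_derDegree_iff.1 hdeg
    have key : ∀ x, x ∈ A → x ∈ C → ∃ p z : SurfaceLieAlgebra R g, p ∈ grade R g (n + 1) ∧
        p ∈ cutIdeal R g A ∧ z ∈ grade R g (n + 1) ∧ z ∈ cutIdeal R g C ∧ p + z = D (gen R g x) :=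
      fun x hxA hxC => exists_graded_split (hits_of_coord hA) (hgr x) (hpair x hxA hxC)
    choose! p z hp using key
    let va : Fin g × Bool → SurfaceLieAlgebra R g := fun x =>
      if x ∈ A then (if x ∈ C then p x else 0) else D (gen R g x)
    let vc : Fin g × Bool → SurfaceLieAlgebra R g := fun x =>
      if x ∈ A then (if x ∈ C then z x else D (gen R g x)) else 0
    have hsumv : ∀ x, va x + vc x = D (gen R g x) := by
      intro x
      by_cases hxA : x ∈ A <;> by_cases hxC : x ∈ C <;> simp [va, vc, hxA, hxC]
      exact (hp x hxA hxC).2.2.2.2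
    have hva_grade : ∀ x, va x ∈ grade R g (n + 1) := by
      intro x
      by_cases hxA : x ∈ A <;> by_cases hxC : x ∈ C <;>
        simp only [va, hxA, hxC, if_true, if_false] <;>
        first
          | exact Submodule.zero_mem _
          | exact hgr x
          | exact (hp x hxA hxC).1
    have hvc_grade : ∀ x, vc x ∈ grade R g (n + 1) := by
      intro x
      by_cases hxA : x ∈ A <;> by_cases hxC : x ∈ C <;>
        simp only [vc, hxA, hxC, if_true, if_false] <;>
        first
          | exact Submodule.zero_mem _
          | exact hgr x
          | exact (hp x hxA hxC).2.2.1
    have hva_A : ∀ x ∈ A, va x ∈ cutIdeal R g A := by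
      intro x hxA
      by_cases hxC : x ∈ C <;> simp only [va, hxA, hxC, if_true, if_false]
      · exact (hp x hxA hxC).2.1
      · exact LieSubmodule.zero_mem _
    have hvc_C : ∀ x ∈ C, vc x ∈ cutIdeal R g C := by
      intro x hxC
      by_cases hxA : x ∈ A <;> simp only [vc, hxA, hxC, if_true, if_false]
      · exact (hp x hxA hxC).2.2.2.1
      · exact LieSubmodule.zero_mem _
    have hΦ : (∑ i : Fin g, (⁅a R g i, va (i, true)⁆ - ⁅b R g i, va (i, false)⁆)) + (∑ i : Fin g,
        (⁅a R g i, vc (i, true)⁆ - ⁅b R g i, vc (i, false)⁆)) = 0 := by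
      rw [← phi_add, show va + vc = fun x => D (gen R g x) from funext fun x => hsumv x]
      exact phi_derivation D
    have hqA : (∑ i : Fin g, (⁅a R g i, va (i, true)⁆ - ⁅b R g i, va (i, false)⁆)) ∈ cutIdeal R g A
        := phi_mem_cutIdeal (hits_of_coord hA) hva_A
    have hqC : (∑ i : Fin g, (⁅a R g i, va (i, true)⁆ - ⁅b R g i, va (i, false)⁆)) ∈ cutIdeal R g C
        := by
      have h1 : (∑ i : Fin g, (⁅a R g i, vc (i, true)⁆ - ⁅b R g i, vc (i, false)⁆)) ∈ cutIdeal R g C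
          := phi_mem_cutIdeal (hits_of_coord hC) hvc_C
      rw [eq_neg_of_add_eq_zero_right hΦ] at h1
      exact neg_mem_iff.1 h1
    have hq : (∑ i : Fin g, (⁅a R g i, va (i, true)⁆ - ⁅b R g i, va (i, false)⁆)) ∈ grade R g (n +
        2) := phi_mem_grade hva_grade
    obtain ⟨r, hr, hrA, hrC, hrq⟩ := exists_correction₂ hA hC hq hqA hqC
    obtain ⟨E₁, hE₁⟩ := exists_derivation (va - r) (by
      have := phi_sub va r
      rw [hrq, sub_self] at this
      simpa [a, b] using this)
    obtain ⟨E₂, hE₂⟩ := exists_derivation (vc + r) (by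
      have := phi_add vc r
      rw [hrq, eq_neg_of_add_eq_zero_right hΦ, neg_add_cancel] at this
      simpa [a, b] using this)
    have hE₁A : E₁ ∈ cutStabilizerDegree R g A n :=
      mem_cutStabilizerDegree_of_gen (fun x hx => by rw [hE₁]; exact sub_mem (hva_A x hx) (hrA x hx))
        fun x => by rw [hE₁]; exact sub_mem (hva_grade x) (hr x)
    have hE₂C : E₂ ∈ cutStabilizerDegree R g C n :=
      mem_cutStabilizerDegree_of_gen (fun x hx => by rw [hE₂]; exact add_mem (hvc_C x hx) (hrC x hx))
        fun x => by rw [hE₂]; exact add_mem (hvc_grade x) (hr x)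
    have hDE : D = E₁ + E₂ := derivation_ext fun x => by
      rw [LieDerivation.add_apply, hE₁, hE₂, Pi.sub_apply, Pi.add_apply, ← hsumv x]; abel
    rw [hDE]
    exact Submodule.mem_sup.2 ⟨E₁, hE₁A, E₂, hE₂C, rfl⟩

end Pair


end Summit.SmoothPoincare4.SmoothPoincare4.Theorems.LieGateIdentity
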